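import Summits.CriticalPhenomena.Ising3DConformalLimit.Theorems.PrecisionLaplacianMoebiusLimitOfTwoPointLawBareExistence
import Summits.CriticalPhenomena.Ising3DConformalLimit.Theorems.EnergyNotSigmaSquaredMoebiusLimitExistsHrpFactorisation
import HarnessLib

/-!
# Crux `MoebiusLimitOfTwoPointLaw` (item stmt-CriticalPhenomena-4801): EXACT factorisation through bare existence
# (line `multipole-ward-nonsat-endpoint`, lead c2; `--supports stmt-CriticalPhenomena-4801`)

Composition of `…BareExistence.lean` (4738 → 1980/8367 → 1982 → crux, the two-point law discharging scale covariance,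
translations, `Δ > 0` and two-point isotropy) with the landed necessity half of the factorisation of item 1344
(`MoebiusLimitExistsOnlyInteraction.limitRotationInvariant_of_MoebiusLimitExists`,
`…inversionUpgradeNormalised_of_MoebiusLimitExists`, p114842):

* `moebiusLimitOfTwoPointLaw_iff_bare  : crux ↔ (0634 → 4738 ∧ 1980 ∧ 1982)`;
* `moebiusLimitOfTwoPointLaw_iff_bare₂ : crux ↔ (0634 → 4738 ∧ 8367 ∧ 1982)`.

So, GIVEN the two-point law, crux 4801 is EXACTLY "bare existence of a non-degenerate pointwise limit (item 4738) + the
`n`-point `O(3)` upgrade (item 8367, ⇔ 1980 under 0634) + the inversion upgrade (item 1982)", each factor necessary, with no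
regularity, translation, scale-covariance or two-point-isotropy debt. No definitions, no `sorry`.
-/

noncomputable section

namespace Summit.CriticalPhenomena.Ising3DConformalLimit.PrecisionLaplacianMoebiusLimitOfTwoPointLaw

open Literature.Probability.LatticeModels
open Summit.CriticalPhenomena.Ising3DConformalLimit.Theses
open Summit.CriticalPhenomena.Ising3DConformalLimit.MoebiusLimitExistsOnlyInteraction
  (limitRotationInvariant_of_MoebiusLimitExists inversionUpgradeNormalised_of_MoebiusLimitExists)

/-- **Exact factorisation of crux 4801 through existing items.** `MoebiusLimitOfTwoPointLaw` holds iff, under its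
own hypothesis (item 0634), the three items 4738 (bare existence of a non-degenerate pointwise limit), 1980 (`O(3)`
upgrade) and 1982 (inversion upgrade) hold: sufficiency is `moebiusLimitOfTwoPointLaw_of_bare`; necessity forgets the
covariance of the Möbius witness (4738) and transfers it to every limit (1980, 1982). [cite: DuminilCopinICM2022, §8.4 p. 29] -/
theorem moebiusLimitOfTwoPointLaw_iff_bare :
    PrecisionLaplacian.MoebiusLimitOfTwoPointLaw ↔
      (IsingEuclidUpgrade.IsingEuclidUpgradeR2RotInvPowerLaw →
        WeylWindow.LimitExists ∧ HyperoctahedralRP.LimitRotationInvariant ∧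
          HyperoctahedralRP.InversionUpgradeNormalised) := by
  constructor
  · intro h hP
    have hM : PerfectScreening.MoebiusLimitExists := h hP
    refine ⟨?_, limitRotationInvariant_of_MoebiusLimitExists hM,
      inversionUpgradeNormalised_of_MoebiusLimitExists hM⟩
    obtain ⟨ρ, _, S, hρ, _, hlim, hnd, _⟩ := hM
    exact ⟨ρ, S, hρ, hlim, hnd⟩
  · intro h hP
    obtain ⟨hL, h1980, h1982⟩ := h hP
    exact moebiusLimitOfTwoPointLaw_of_bare hL h1980 h1982 hP

/-- The factorisation for the `BernsteinTemperature` spelling. [cite: DuminilCopinICM2022, §8.4 p. 29] -/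
theorem moebiusLimitOfTwoPointLaw_iff_bare' :
    BernsteinTemperature.MoebiusLimitOfTwoPointLaw ↔
      (IsingEuclidUpgrade.IsingEuclidUpgradeR2RotInvPowerLaw →
        WeylWindow.LimitExists ∧ HyperoctahedralRP.LimitRotationInvariant ∧
          HyperoctahedralRP.InversionUpgradeNormalised) :=
  moebiusLimitOfTwoPointLaw_iff_bare

/-- **Exact factorisation of crux 4801, sharpest form.** `MoebiusLimitOfTwoPointLaw` holds iff, under item 0634,
items 4738 (bare existence), 8367 (the `n`-point rotation upgrade from two-point isotropy) and 1982 (the inversion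
upgrade) hold. [cite: DuminilCopinICM2022, §8.4 p. 29] -/
theorem moebiusLimitOfTwoPointLaw_iff_bare₂ :
    PrecisionLaplacian.MoebiusLimitOfTwoPointLaw ↔
      (IsingEuclidUpgrade.IsingEuclidUpgradeR2RotInvPowerLaw →
        WeylWindow.LimitExists ∧ GaussianScaleMixture.RotationUpgradeFromTwoPoint ∧
          HyperoctahedralRP.InversionUpgradeNormalised) := by
  rw [moebiusLimitOfTwoPointLaw_iff_bare]
  constructor
  · intro h hP
    obtain ⟨hL, h1980, h1982⟩ := h hP
    exact ⟨hL, rotationUpgradeFromTwoPoint_of_limitRotationInvariant h1980, h1982⟩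
  · intro h hP
    obtain ⟨hL, h8367, h1982⟩ := h hP
    exact ⟨hL, limitRotationInvariant_of_rotationUpgradeFromTwoPoint hP h8367, h1982⟩

/-- The sharpest factorisation for the `BernsteinTemperature` spelling. [cite: DuminilCopinICM2022, §8.4 p. 29] -/
theorem moebiusLimitOfTwoPointLaw_iff_bare₂' :
    BernsteinTemperature.MoebiusLimitOfTwoPointLaw ↔
      (IsingEuclidUpgrade.IsingEuclidUpgradeR2RotInvPowerLaw →
        WeylWindow.LimitExists ∧ GaussianScaleMixture.RotationUpgradeFromTwoPoint ∧
          HyperoctahedralRP.InversionUpgradeNormalised) :=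
  moebiusLimitOfTwoPointLaw_iff_bare₂

end Summit.CriticalPhenomena.Ising3DConformalLimit.PrecisionLaplacianMoebiusLimitOfTwoPointLaw

end
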